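/-
Origin: expansion seat `prover-pub-hodgecm-mc-binder-2-g14-0`, handover #R2 2026-08-20T11:00Z md5 06240374eb4d (PKG 306fb2ea64ab → 06240374eb4d; 438 l.; arms `kindCoord` (refl) + `kindCoord_sigmaSwap_apply`, `pinnedVac`, `printLoc_χ_pinned`, `vac_apply_eq_pinnedVac`) (`HOME/mc/pub-hodgecm-mc-binder-2/g14/t12/HodgeCM/PerL34/PrintedTorusMatch.lean`, md5 06240374eb4d, 438 lines);
landed by the second packager p2 gen 7 (p2-g7) in gate run 50 REPLACES the earlier landed copy of `HodgeCM/PerL34/PrintedTorusMatch.lean` (seat copy carried the packager Origin header of an earlier run (stripped)).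
-/
import Summits.HodgeConjecture.HodgeCM.PerL34.TorusOccurrence_2
import Summits.HodgeConjecture.HodgeCM.PerL34.FockPrintPlaces

/-!
# PrintedTorusMatch — the S4 torus identification ON THE END STATE (GAPS `pv11g7-A1`, residual (i)–(ii))

Origin: `pub-hodgecm-pv11-g8` (DAG-NODE PROVER #11 gen 8, torus/seesaw/supply lane), 2026-08-18.  ADDITIVE LEAF: nothing
landed or queued is replaced; imports `HodgeCM.PerL34.TorusOccurrence` (pv11-g7, run 28) and
`HodgeCM.PerL34.FockPrintPlaces` (pv12-g7 #3, run 28).  KERNEL theorems only — NOTHING CITED, no hypothesis beyond the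
stated ones, no new open input.

## What this file settles

pv12-g7's `ArchC.PrintedAnalyticSide C D P RP kind lam hlam vac` (`FockPrintBridge`) is the S4 input of Lemma 4.1(c)
over the PRINTED Fock places: every Fock-side field of pv06's `ArchCDatum` / pv12-g4's `FockAnalyticBridge` is kernel
(`printPlaces`, `printPlacesW`, `w_norm`, `w_loc`), leaving the analytic side AND two torus-side data: the chart torus
`ιT : (printPlaces …).Tg →* G` and the field `wOccurs_of_eigenvector` ("a non-zero joint `ιT`-eigenvector of `σ̂_i`
with the chart weight `printPlacesW` makes `D.wOccurs i` true"), together with the one free parameter per place, the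
vacuum character `vac_b : U(1) × U(1) →* U(1)` (D5).  pv11-g7 (`TorusOccurrence` §2–§4) proved `wOccurs_of_eigenvector`
on prl1's representation-theoretic END-STATE records for ANY chart that REPARAMETRISES the end-state torus
(`ιT = D.torus ∘ e`, `w = D.w ∘ e`, `e` surjective), and (§5) put the end-state torus `T(L₀ ⊗ ℝ) = SeesawArchTorus L`
with its typed weight `weight L m₁ m₂` in place coordinates `∏_w U(1) × U(1)` (`placesEquiv`, `placesWeight`).  It left
(GAPS pv11g7-A1 (i)–(ii)) the identification of the PRINTED chart torus `(printPlaces …).Tg = Π_b (printLoc …).T` with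
those coordinates and the pinning of `vac_b`.  Here:

* §1 `kindCoord` / `placesCoord` — each printed local torus `(printLoc λ hλ vac k).T` IS `U(1) × U(1)` (all three
  constructors `ofPrintMCircle / ofPrintECircle / ofPrintICircle` have `T := Circle × Circle`, `rfl`), assembled into the
  `MulEquiv` `placesCoord : (printPlaces RP kind lam hlam vac).Tg ≃* (RP → Circle × Circle)`.
* §2 `pinnedVac k n₁ n₂ : U(1) × U(1) →* U(1)` — the vacuum character FORCED by the typed weight exponents `(n₁, n₂)` at a
  place of kind `k`: `u ↦ u₁^{-n₁} u₂^{-n₂}` at `Σ₁₂ / D₁₂` (vacuum `1`, polynomial weight `0`) and `u ↦ u₁^{-n₁-1} u₂^{-n₂-1}`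
  at `ι₁` (vacuum `det z`, polynomial weight `(1,1)`); `printPlacesW_pinned`: with `vac := pinnedVacs kind m₁ m₂` the
  printed archimedean type character IS `t ↦ ∏_b u_{b,1}^{m₁ b} u_{b,2}^{m₂ b}` in coordinates — KERNEL.
* §3 `printPlacesW_eq_iff` — and CONVERSELY: the printed chart weight equals that coordinate weight for all `t` IFF
  `vac = pinnedVacs kind m₁ m₂` (adv2g23-X49: the `[DEFINITIONAL]` vacuum-character parameter is `[DETERMINED]` by the
  weight-matching condition `w = D.w ∘ e`; pinning loses no generality).
* §4 ON THE END STATE (`RP := InfinitePlace L`, prl1-g4 `AdelicTorusCompactInput`: `Tι := SeesawArchTorus L`,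
  `torus := jT ∘ toAdeles`, `w := SeesawArchTorus.weight L m₁ m₂`): `printPlacesW_pinned_eq_weight` (the printed weight IS
  the typed weight through `placesEquiv⁻¹ ∘ placesCoord`), `printPlacesW_eq_weight_iff` (and only for the pinned `vac`),
  the canonical chart torus `printedTorusHom torus … := torus ∘ placesEquiv⁻¹ ∘ placesCoord` (a monoid hom, the `ιT`
  field), and the S4 field DISCHARGED: `SeesawArchTorus.wOccurs_of_printedEigenvector` (generic unitary `R`),
  `RepTorusCarrier.wOccurs_of_printedEigenvector` / `toTorusData_wOccurs_of_printedEigenvector` (prl1's carriers, the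
  latter in the LITERAL binder shape of `PrintedAnalyticSide.wOccurs_of_eigenvector` over
  `C.toCoreCarrier.toIsolationCore h`, `D.toTorusCarrier.toTorusData h hD`, `vac := pinnedVacs kind m₁ m₂`).

Consequence for the ledger of open inputs: on the end state the S4 record `PrintedAnalyticSide` is inhabited from its
ANALYTIC fields alone (`TΦc_add … hH`, with `ιT := printedTorusHom …` and `vac := pinnedVacs kind m₁ m₂`), the last field
being `toTorusData_wOccurs_of_printedEigenvector … (fun _ => rfl)`.  The price of pinning is visible, not hidden: the
analytic field `omg_ins` then asserts that the GENUINE Weil-representation action of `T_b` on `φ ⊗ Φ_f` has the pinned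
vacuum character — which is exactly N26's printed dictionary `e_b(Ψ_i)` (Adams; KV78), an analytic-side statement.

PerL v5 references (for the verbatim check): ll. 470–475, 485–486 ("`T_b` acts on `φ⁰_b` by the character `−w_b`"),
496–511 (the three local models; l. 510 "acts by det"), 522–523 ("hence σ … occurs").
-/

set_option autoImplicit false

noncomputable section

open Complex
open scoped BigOperators

namespace HodgeCM
namespace PerL34
namespace Fock
namespace PrintDict

/-! ## §1  Coordinates: every printed local torus is `U(1) × U(1)` -/

section Coord

variable (lam : ℂ) (hlam : lam ≠ 0) (vac : Circle × Circle →* Circle)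

/-- The printed local torus of each kind IS `U(1) × U(1)` (`ofPrintMCircle / ofPrintECircle / ofPrintICircle` all have
`T := Circle × Circle` definitionally): the identity, as a `MulEquiv`, by cases on the kind. -/
def kindCoord : (k : PlaceKind) → ((printLoc lam hlam vac k).T ≃* (Circle × Circle))
  | .sigma => MulEquiv.refl _
  | .delta => MulEquiv.refl _
  | .iota => MulEquiv.refl _
  | .sigmaSwap => MulEquiv.refl _

/-- (Ported verbatim from the HodgeCMPerL package; no docstring in the source.) -/
theorem kindCoord_sigma_apply (t : (printLoc lam hlam vac .sigma).T) : kindCoord lam hlam vac .sigma t = t := rfl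
/-- (Ported verbatim from the HodgeCMPerL package; no docstring in the source.) -/
theorem kindCoord_delta_apply (t : (printLoc lam hlam vac .delta).T) : kindCoord lam hlam vac .delta t = t := rfl
/-- (Ported verbatim from the HodgeCMPerL package; no docstring in the source.) -/
theorem kindCoord_iota_apply (t : (printLoc lam hlam vac .iota).T) : kindCoord lam hlam vac .iota t = t := rfl
/-- (Ported verbatim from the HodgeCMPerL package; no docstring in the source.) -/
theorem kindCoord_sigmaSwap_apply (t : (printLoc lam hlam vac .sigmaSwap).T) : kindCoord lam hlam vac .sigmaSwap t = t := rfl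

end Coord

/-! ## §2  The pinned vacuum characters and the printed weight in coordinates -/

/-- The unitary character `u ↦ u₁^a · u₂^b` of `U(1) × U(1)`. -/
def circleZPow (a b : ℤ) : Circle × Circle →* Circle where
  toFun u := u.1 ^ a * u.2 ^ b
  map_one' := by rw [Prod.fst_one, Prod.snd_one, one_zpow, one_zpow, mul_one]
  map_mul' u v := by rw [Prod.fst_mul, Prod.snd_mul, mul_zpow, mul_zpow, mul_mul_mul_comm]

/-- (Ported verbatim from the HodgeCMPerL package; no docstring in the source.) -/
theorem circleZPow_apply (a b : ℤ) (u : Circle × Circle) : circleZPow a b u = u.1 ^ a * u.2 ^ b := rfl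

/-- (Ported verbatim from the HodgeCMPerL package; no docstring in the source.) -/
theorem coe_circleZPow (a b : ℤ) (u : Circle × Circle) :
    ((circleZPow a b u : Circle) : ℂ) = ((u.1 : Circle) : ℂ) ^ a * ((u.2 : Circle) : ℂ) ^ b := by
  rw [circleZPow_apply, Circle.coe_mul, Circle.coe_zpow, Circle.coe_zpow]

/-- (Ported verbatim from the HodgeCMPerL package; no docstring in the source.) -/
theorem circleZPow_neg (n₁ n₂ : ℤ) (u : Circle × Circle) :
    circleZPow (-n₁) (-n₂) u = (u.1 ^ n₁ * u.2 ^ n₂)⁻¹ := by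
  rw [circleZPow_apply, zpow_neg, zpow_neg, mul_inv]

/-- `u₁^{-n₁-1} u₂^{-n₂-1} · (u₁u₂) = (u₁^{n₁} u₂^{n₂})⁻¹` in the compact torus (no division by zero anywhere). -/
theorem circleZPow_neg_sub_one_mul (n₁ n₂ : ℤ) (u : Circle × Circle) :
    circleZPow (-n₁ - 1) (-n₂ - 1) u * (u.1 * u.2) = (u.1 ^ n₁ * u.2 ^ n₂)⁻¹ := by
  rw [circleZPow_apply, mul_mul_mul_comm (u.1 ^ (-n₁ - 1)) (u.2 ^ (-n₂ - 1)) u.1 u.2, ← zpow_add_one,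
    ← zpow_add_one, sub_add_cancel, sub_add_cancel, zpow_neg, zpow_neg, mul_inv]

/-- (Ported verbatim from the HodgeCMPerL package; no docstring in the source.) -/
theorem coe_circleZPow_neg (n₁ n₂ : ℤ) (u : Circle × Circle) :
    ((circleZPow (-n₁) (-n₂) u : Circle) : ℂ) = (((u.1 : Circle) : ℂ) ^ n₁ * ((u.2 : Circle) : ℂ) ^ n₂)⁻¹ := by
  rw [circleZPow_neg, Circle.coe_inv, Circle.coe_mul, Circle.coe_zpow, Circle.coe_zpow]

/-- (Ported verbatim from the HodgeCMPerL package; no docstring in the source.) -/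
theorem coe_circleZPow_neg_sub_one_mul (n₁ n₂ : ℤ) (u : Circle × Circle) :
    ((circleZPow (-n₁ - 1) (-n₂ - 1) u : Circle) : ℂ) * (((u.1 : Circle) : ℂ) * ((u.2 : Circle) : ℂ)) =
      (((u.1 : Circle) : ℂ) ^ n₁ * ((u.2 : Circle) : ℂ) ^ n₂)⁻¹ := by
  rw [← Circle.coe_mul u.1 u.2, ← Circle.coe_mul, circleZPow_neg_sub_one_mul, Circle.coe_inv, Circle.coe_mul,
    Circle.coe_zpow, Circle.coe_zpow]

/-- **The pinned vacuum character** of a place of kind `k` with typed weight exponents `(n₁, n₂)` ([PerL] l. 485–486: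
`T_b` acts on `φ⁰_b` by the character `−w_b`, i.e. `χ_b = w_b⁻¹ = u₁^{-n₁} u₂^{-n₂}`; the tree's `w_loc : pl.χ t = (w t)⁻¹`):
since `χ_b = vac_b · (u₁u₂)^{δ_k}` (`printLoc_χ_sigma` / `_delta` / `_iota`), `vac_b` must be `u₁^{-n₁} u₂^{-n₂}` at `Σ₁₂ / D₁₂` and
`u₁^{-n₁-1} u₂^{-n₂-1}` at `ι₁` (the chart and `χ = vac` at `Σ₁₂` do not see the (T12) orientation: same pin at `sigmaSwap`). -/
def pinnedVac : PlaceKind → ℤ → ℤ → (Circle × Circle →* Circle)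
  | .sigma, n₁, n₂ => circleZPow (-n₁) (-n₂)
  | .delta, n₁, n₂ => circleZPow (-n₁) (-n₂)
  | .iota, n₁, n₂ => circleZPow (-n₁ - 1) (-n₂ - 1)
  | .sigmaSwap, n₁, n₂ => circleZPow (-n₁) (-n₂)

section Pinned

variable (lam : ℂ) (hlam : lam ≠ 0)

/-- With the pinned vacuum character the printed local character IS `u ↦ (u₁^{n₁} u₂^{n₂})⁻¹` in coordinates, at every
kind (KERNEL; at `ι₁` the extra `det = u₁u₂` of `φ⁰ = det z` cancels the shift). -/
theorem printLoc_χ_pinned (n₁ n₂ : ℤ) : ∀ (k : PlaceKind) (t : (printLoc lam hlam (pinnedVac k n₁ n₂) k).T),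
    (printLoc lam hlam (pinnedVac k n₁ n₂) k).χ t =
      ((((kindCoord lam hlam (pinnedVac k n₁ n₂) k t).1 : Circle) : ℂ) ^ n₁ *
        (((kindCoord lam hlam (pinnedVac k n₁ n₂) k t).2 : Circle) : ℂ) ^ n₂)⁻¹
  | .sigma, t => coe_circleZPow_neg n₁ n₂ t
  | .delta, t => (printLoc_χ_delta lam hlam _ t).trans (coe_circleZPow_neg n₁ n₂ t)
  | .iota, t => (printLoc_χ_iota lam hlam _ t).trans (coe_circleZPow_neg_sub_one_mul n₁ n₂ t)
  | .sigmaSwap, t => coe_circleZPow_neg n₁ n₂ t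

variable (vac : Circle × Circle →* Circle)

/-- Conversely (KERNEL): if the printed local character of kind `k` is `u ↦ (u₁^{n₁} u₂^{n₂})⁻¹` in coordinates, its
vacuum character IS the pinned one. -/
theorem vac_apply_eq_pinnedVac (n₁ n₂ : ℤ) : ∀ (k : PlaceKind) (u : Circle × Circle),
    (printLoc lam hlam vac k).χ ((kindCoord lam hlam vac k).symm u) =
      ((((u.1 : Circle) : ℂ)) ^ n₁ * ((u.2 : Circle) : ℂ) ^ n₂)⁻¹ →
    vac u = pinnedVac k n₁ n₂ u
  | .sigma, u, h => Circle.ext (h.trans (coe_circleZPow_neg n₁ n₂ u).symm)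
  | .delta, u, h => Circle.ext (((printLoc_χ_delta lam hlam vac u).symm.trans h).trans (coe_circleZPow_neg n₁ n₂ u).symm)
  | .iota, u, h =>
    have hxy : ((u.1 : Circle) : ℂ) * ((u.2 : Circle) : ℂ) ≠ 0 :=
      mul_ne_zero (Circle.coe_ne_zero _) (Circle.coe_ne_zero _)
    Circle.ext ((eq_div_of_mul_eq hxy ((printLoc_χ_iota lam hlam vac u).symm.trans h)).trans
      (eq_div_of_mul_eq hxy (coe_circleZPow_neg_sub_one_mul n₁ n₂ u)).symm)
  | .sigmaSwap, u, h => Circle.ext (h.trans (coe_circleZPow_neg n₁ n₂ u).symm)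

end Pinned

/-- The pinned vacuum characters of all places `b : RP`, from the kinds and the typed weight exponents `(m₁ b, m₂ b)`. -/
def pinnedVacs {RP : Type} (kind : RP → PlaceKind) (m₁ m₂ : RP → ℤ) : RP → (Circle × Circle →* Circle) :=
  fun b => pinnedVac (kind b) (m₁ b) (m₂ b)

/-- (Ported verbatim from the HodgeCMPerL package; no docstring in the source.) -/
theorem pinnedVacs_apply {RP : Type} (kind : RP → PlaceKind) (m₁ m₂ : RP → ℤ) (b : RP) :
    pinnedVacs kind m₁ m₂ b = pinnedVac (kind b) (m₁ b) (m₂ b) := rfl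

section Places

variable (RP : Type) [Fintype RP] [DecidableEq RP] (kind : RP → PlaceKind) (lam : RP → ℂ) (hlam : ∀ b, lam b ≠ 0)
  (vac : RP → (Circle × Circle →* Circle))

/-- **The printed torus in place coordinates**: `T(L₀ ⊗ ℝ) = Π_b (printLoc …).T ≃* Π_b U(1) × U(1)`, place by place the
identity (`kindCoord`). -/
def placesCoord : (printPlaces RP kind lam hlam vac).Tg ≃* (RP → Circle × Circle) :=
  MulEquiv.piCongrRight fun b => kindCoord (lam b) (hlam b) (vac b) (kind b)

/-- (Ported verbatim from the HodgeCMPerL package; no docstring in the source.) -/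
theorem placesCoord_apply (t : (printPlaces RP kind lam hlam vac).Tg) (b : RP) :
    placesCoord RP kind lam hlam vac t b = kindCoord (lam b) (hlam b) (vac b) (kind b) (t b) := rfl

/-- (Ported verbatim from the HodgeCMPerL package; no docstring in the source.) -/
theorem placesCoord_symm_apply (g : RP → Circle × Circle) (b : RP) :
    (placesCoord RP kind lam hlam vac).symm g b = (kindCoord (lam b) (hlam b) (vac b) (kind b)).symm (g b) := rfl

/-- The joint character of the pinned printed places in coordinates (KERNEL): `χ(t) = (∏_b u_{b,1}^{m₁ b} u_{b,2}^{m₂ b})⁻¹`. -/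
theorem printPlaces_χ_pinned (m₁ m₂ : RP → ℤ) (t : (printPlaces RP kind lam hlam (pinnedVacs kind m₁ m₂)).Tg) :
    (printPlaces RP kind lam hlam (pinnedVacs kind m₁ m₂)).χ t =
      (∏ b, ((((placesCoord RP kind lam hlam (pinnedVacs kind m₁ m₂) t b).1 : Circle) : ℂ) ^ (m₁ b) *
        (((placesCoord RP kind lam hlam (pinnedVacs kind m₁ m₂) t b).2 : Circle) : ℂ) ^ (m₂ b)))⁻¹ := by
  rw [printPlaces_χ, ← Finset.prod_inv_distrib]
  exact Finset.prod_congr rfl fun b _ => printLoc_χ_pinned (lam b) (hlam b) (m₁ b) (m₂ b) (kind b) (t b)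

/-- **The printed archimedean type character with pinned vacuum characters, in coordinates (KERNEL)**:
`w(t) = ∏_b u_{b,1}^{m₁ b} · u_{b,2}^{m₂ b}`, `u := placesCoord t` — the typed weight of exponents `(m₁, m₂)`. -/
theorem printPlacesW_pinned (m₁ m₂ : RP → ℤ) (t : (printPlaces RP kind lam hlam (pinnedVacs kind m₁ m₂)).Tg) :
    printPlacesW RP kind lam hlam (pinnedVacs kind m₁ m₂) t =
      ∏ b, ((((placesCoord RP kind lam hlam (pinnedVacs kind m₁ m₂) t b).1 : Circle) : ℂ) ^ (m₁ b) *
        (((placesCoord RP kind lam hlam (pinnedVacs kind m₁ m₂) t b).2 : Circle) : ℂ) ^ (m₂ b)) := by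
  rw [printPlacesW_apply, printPlaces_χ_pinned, inv_inv]

/-! ## §3  The converse: the weight-matching condition DETERMINES the vacuum characters (adv2g23-X49) -/

/-- If the printed chart weight of `vac` is the coordinate weight of exponents `(m₁, m₂)`, then at each place the local
character on `U(1) × U(1)` is `(u₁^{m₁ b} u₂^{m₂ b})⁻¹` (evaluate at `t` supported at `b`). -/
theorem χ_kindCoord_symm_of_printPlacesW (m₁ m₂ : RP → ℤ)
    (h : ∀ t : (printPlaces RP kind lam hlam vac).Tg, printPlacesW RP kind lam hlam vac t =
      ∏ b, ((((placesCoord RP kind lam hlam vac t b).1 : Circle) : ℂ) ^ (m₁ b) *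
        (((placesCoord RP kind lam hlam vac t b).2 : Circle) : ℂ) ^ (m₂ b)))
    (b : RP) (u : Circle × Circle) :
    (printLoc (lam b) (hlam b) (vac b) (kind b)).χ ((kindCoord (lam b) (hlam b) (vac b) (kind b)).symm u) =
      ((((u.1 : Circle) : ℂ)) ^ (m₁ b) * ((u.2 : Circle) : ℂ) ^ (m₂ b))⁻¹ := by
  have hL : (printPlaces RP kind lam hlam vac).χ ((placesCoord RP kind lam hlam vac).symm (Pi.mulSingle b u)) =
      (printLoc (lam b) (hlam b) (vac b) (kind b)).χ ((kindCoord (lam b) (hlam b) (vac b) (kind b)).symm u) := by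
    show (∏ b' : RP, (printLoc (lam b') (hlam b') (vac b') (kind b')).χ
        ((kindCoord (lam b') (hlam b') (vac b') (kind b')).symm ((Pi.mulSingle b u : RP → Circle × Circle) b'))) = _
    rw [Finset.prod_eq_single b]
    · rw [Pi.mulSingle_eq_same]
    · intro b' _ hb'
      rw [Pi.mulSingle_eq_of_ne hb', map_one]
      exact printLoc_χ_one _ _ _ _
    · exact fun hb => (hb (Finset.mem_univ b)).elim
  have hR : (∏ b', ((((Pi.mulSingle b u : RP → Circle × Circle) b').1 : Circle) : ℂ) ^ (m₁ b') *
      ((((Pi.mulSingle b u : RP → Circle × Circle) b').2 : Circle) : ℂ) ^ (m₂ b')) =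
      ((u.1 : Circle) : ℂ) ^ (m₁ b) * ((u.2 : Circle) : ℂ) ^ (m₂ b) := by
    rw [Finset.prod_eq_single b]
    · rw [Pi.mulSingle_eq_same]
    · intro b' _ hb'
      rw [Pi.mulSingle_eq_of_ne hb', Prod.fst_one, Prod.snd_one, Circle.coe_one, one_zpow, one_zpow, mul_one]
    · exact fun hb => (hb (Finset.mem_univ b)).elim
  have ht := h ((placesCoord RP kind lam hlam vac).symm (Pi.mulSingle b u))
  rw [MulEquiv.apply_symm_apply, printPlacesW_apply, hL, hR] at ht
  rw [← ht, inv_inv]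

/-- **The vacuum characters are DETERMINED (KERNEL)**: the printed chart weight is the coordinate weight of exponents
`(m₁, m₂)` only if `vac = pinnedVacs kind m₁ m₂`. -/
theorem eq_pinnedVacs_of_printPlacesW (m₁ m₂ : RP → ℤ)
    (h : ∀ t : (printPlaces RP kind lam hlam vac).Tg, printPlacesW RP kind lam hlam vac t =
      ∏ b, ((((placesCoord RP kind lam hlam vac t b).1 : Circle) : ℂ) ^ (m₁ b) *
        (((placesCoord RP kind lam hlam vac t b).2 : Circle) : ℂ) ^ (m₂ b))) :
    vac = pinnedVacs kind m₁ m₂ :=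
  funext fun b => MonoidHom.ext fun u =>
    vac_apply_eq_pinnedVac (lam b) (hlam b) (vac b) (m₁ b) (m₂ b) (kind b) u
      (χ_kindCoord_symm_of_printPlacesW RP kind lam hlam vac m₁ m₂ h b u)

/-- **§2 ∧ §3 (KERNEL)**: the printed chart weight IS the coordinate weight of exponents `(m₁, m₂)` IFF the vacuum
characters are the pinned ones — the one `[DEFINITIONAL]` parameter of the printed places is `[DETERMINED]` by the typed
weight (adv2g23-X49), and pinning it loses no generality. -/
theorem printPlacesW_eq_iff (m₁ m₂ : RP → ℤ) :
    (∀ t : (printPlaces RP kind lam hlam vac).Tg, printPlacesW RP kind lam hlam vac t =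
      ∏ b, ((((placesCoord RP kind lam hlam vac t b).1 : Circle) : ℂ) ^ (m₁ b) *
        (((placesCoord RP kind lam hlam vac t b).2 : Circle) : ℂ) ^ (m₂ b))) ↔
    vac = pinnedVacs kind m₁ m₂ := by
  refine ⟨eq_pinnedVacs_of_printPlacesW RP kind lam hlam vac m₁ m₂, ?_⟩
  rintro rfl
  exact printPlacesW_pinned RP kind lam hlam m₁ m₂

end Places

end PrintDict
end Fock
end PerL34
end HodgeCM

/-! ## §4  On the end state: `RP := InfinitePlace L`, torus `SeesawArchTorus L`, weight `weight L m₁ m₂` -/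

namespace NumberField
namespace SeesawArchTorus

open HodgeCM.PerL34.Fock HodgeCM.PerL34.Fock.PrintDict

variable {L : Type} [Field L] [NumberField L] [IsCMField L] [DecidableEq (InfinitePlace L)]
variable (kind : InfinitePlace L → PlaceKind) (lam : InfinitePlace L → ℂ) (hlam : ∀ w, lam w ≠ 0)

/-- **The printed weight IS the typed weight (KERNEL)**: with the pinned vacuum characters,
`printPlacesW t = placesWeight L m₁ m₂ (placesCoord t) = weight L m₁ m₂ ((placesEquiv L)⁻¹ (placesCoord t))`. -/
theorem printPlacesW_pinned_eq_placesWeight (m₁ m₂ : InfinitePlace L → ℤ)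
    (t : (printPlaces (InfinitePlace L) kind lam hlam (pinnedVacs kind m₁ m₂)).Tg) :
    printPlacesW (InfinitePlace L) kind lam hlam (pinnedVacs kind m₁ m₂) t =
      placesWeight L m₁ m₂ (placesCoord (InfinitePlace L) kind lam hlam (pinnedVacs kind m₁ m₂) t) := by
  rw [printPlacesW_pinned, placesWeight_apply]

/-- (Ported verbatim from the HodgeCMPerL package; no docstring in the source.) -/
theorem printPlacesW_pinned_eq_weight (m₁ m₂ : InfinitePlace L → ℤ)
    (t : (printPlaces (InfinitePlace L) kind lam hlam (pinnedVacs kind m₁ m₂)).Tg) :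
    printPlacesW (InfinitePlace L) kind lam hlam (pinnedVacs kind m₁ m₂) t =
      weight L m₁ m₂ ((placesEquiv L).symm
        (placesCoord (InfinitePlace L) kind lam hlam (pinnedVacs kind m₁ m₂) t)) := by
  rw [printPlacesW_pinned, weight_placesEquiv_symm]

/-- **The weight-matching condition `w = D.w ∘ e` of the end-state chart holds IFF `vac` is pinned (KERNEL).** -/
theorem printPlacesW_eq_weight_iff (vac : InfinitePlace L → (Circle × Circle →* Circle)) (m₁ m₂ : InfinitePlace L → ℤ) :
    (∀ t : (printPlaces (InfinitePlace L) kind lam hlam vac).Tg, printPlacesW (InfinitePlace L) kind lam hlam vac t =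
      weight L m₁ m₂ ((placesEquiv L).symm (placesCoord (InfinitePlace L) kind lam hlam vac t))) ↔
    vac = pinnedVacs kind m₁ m₂ := by
  simp only [weight_placesEquiv_symm]
  exact printPlacesW_eq_iff (InfinitePlace L) kind lam hlam vac m₁ m₂

section Chart

variable {G : Type*} [Group G]

/-- **The canonical chart torus** `ιT := torus ∘ (placesEquiv L)⁻¹ ∘ placesCoord : T_print(L₀ ⊗ ℝ) →* G` of a printed
chart over an end-state torus `torus : SeesawArchTorus L →* G` (intended: `jT.toMonoidHom.comp (toAdeles L)`) — a MONOID
HOM, as the field `PrintedAnalyticSide.ιT` requires. -/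
def printedTorusHom (torus : SeesawArchTorus L →* G) (vac : InfinitePlace L → (Circle × Circle →* Circle)) :
    (printPlaces (InfinitePlace L) kind lam hlam vac).Tg →* G :=
  torus.comp (((placesEquiv L).symm : (InfinitePlace L → Circle × Circle) ≃* SeesawArchTorus L).toMonoidHom.comp
    (placesCoord (InfinitePlace L) kind lam hlam vac).toMonoidHom)

/-- (Ported verbatim from the HodgeCMPerL package; no docstring in the source.) -/
theorem printedTorusHom_apply (torus : SeesawArchTorus L →* G) (vac : InfinitePlace L → (Circle × Circle →* Circle))
    (t : (printPlaces (InfinitePlace L) kind lam hlam vac).Tg) :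
    printedTorusHom kind lam hlam torus vac t =
      torus ((placesEquiv L).symm (placesCoord (InfinitePlace L) kind lam hlam vac t)) := rfl

end Chart

section EndState

variable {H : Type*} [NormedAddCommGroup H] [InnerProductSpace ℂ H] [CompleteSpace H]
variable {G : Type*} [Group G]

/-- **The S4 field `wOccurs_of_eigenvector` for the PRINTED chart, on the end-state torus (KERNEL).**  For a unitary
`R : G →* (H →L[ℂ] H)`, a torus `torus : SeesawArchTorus L → G` with the typed weight `weight L m₁ m₂`, and the printed
places with the PINNED vacuum characters and ANY chart torus `ιT` that is `torus` in coordinates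
(`ιT t = torus ((placesEquiv L)⁻¹ (placesCoord t))`, e.g. `printedTorusHom`, `rfl`): a non-zero vector of
`σ̂_c = closure (isotypic R c)` on which every `t ∈ T_print(L₀ ⊗ ℝ)` acts through `ιT` by the printed weight
`printPlacesW t` makes `weight L m₁ m₂` OCCUR in the class `c`. -/
theorem wOccurs_of_printedEigenvector {R : G →* (H →L[ℂ] H)} (hU : HodgeCM.PerL34.Spectral.IsUnitaryRep R)
    (torus : SeesawArchTorus L → G) (m₁ m₂ : InfinitePlace L → ℤ)
    (ιT : (printPlaces (InfinitePlace L) kind lam hlam (pinnedVacs kind m₁ m₂)).Tg → G)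
    (hι : ∀ t, ιT t = torus ((placesEquiv L).symm
      (placesCoord (InfinitePlace L) kind lam hlam (pinnedVacs kind m₁ m₂) t)))
    (c : HodgeCM.RepDecomp.IsoClass R)
    (h : ∃ y ∈ (HodgeCM.RepDecomp.isotypic R c).topologicalClosure, y ≠ 0 ∧
      ∀ t : (printPlaces (InfinitePlace L) kind lam hlam (pinnedVacs kind m₁ m₂)).Tg,
        R (ιT t) y = printPlacesW (InfinitePlace L) kind lam hlam (pinnedVacs kind m₁ m₂) t • y) :
    HodgeCM.RepDecomp.WOccurs R torus (weight L m₁ m₂) c := by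
  obtain ⟨y, hy, hy0, hyt⟩ := h
  refine wOccurs_of_placesEigenvector L hU torus m₁ m₂ c ⟨y, hy, hy0, fun f => ?_⟩
  have ht := hyt ((placesCoord (InfinitePlace L) kind lam hlam (pinnedVacs kind m₁ m₂)).symm f)
  rw [hι, printPlacesW_pinned_eq_placesWeight, MulEquiv.apply_symm_apply] at ht
  exact ht

end EndState

end SeesawArchTorus
end NumberField

/-! ## §5  The same for prl1's representation-theoretic carriers, in the literal S4 binder shapes -/

namespace HodgeCM
namespace RepTorusCarrier

open NumberField NumberField.SeesawArchTorus HodgeCM.PerL34.Fock HodgeCM.PerL34.Fock.PrintDict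

variable {HH HG CG GG SK SigIdxG : Type}
variable [NormedAddCommGroup HH] [InnerProductSpace ℂ HH] [CompleteSpace HH]
variable [NormedAddCommGroup HG] [InnerProductSpace ℂ HG] [CompleteSpace HG]
variable [NormedAddCommGroup CG] [NormedSpace ℂ CG]
variable [Group GG] [TopologicalSpace GG] [TopologicalSpace SK]
variable {C : RepCoreCarrier HH HG CG GG SK SigIdxG} (D : RepTorusCarrier C)
variable {L : Type} [Field L] [NumberField L] [IsCMField L] [DecidableEq (InfinitePlace L)]
variable (kind : InfinitePlace L → PlaceKind) (lam : InfinitePlace L → ℂ) (hlam : ∀ w, lam w ≠ 0)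


-- port_pkg: scope closed for this part
end RepTorusCarrier
end HodgeCM
end
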